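/-
Copyright (c) 2026 the pub-hodgecm-mathlib formalisation cell (harness21).  Prover seat hodgecm-mathlib-LH4-p11 (g7), req620 Track A «(D-RAM) FOUR-FRAME» squad, helper lane
on h413 = stmt-HodgeConjecture-24833 (count-neutral).  Dealer LH4-plan (g12) WORD #40 «(J-lev-frame)»: the frame-currency (J) SOCKET for the LEVEL ∕ square-level pieces.
2026-09-04.
-/
import Summits.HodgeConjecture.HodgeConjecture.Theorems.F0P3cDyRamPieceRowsOfSignedCensus        -- ★ p858674 (this seat): (J) `pieceRowsWild_of_signedCensus` (any piece, literal currency)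
import Summits.HodgeConjecture.HodgeConjecture.Theorems.F0P3cDyRamLevelCountCentralRescaling     -- ★ p858792 (this seat): `ncard_levels_eq_of_coe_eq_smul`, `ncard_sqLevel_eq_of_coe_eq_smul`
import Summits.HodgeConjecture.HodgeConjecture.Theorems.F0P3cDyRamSignedCensusLiteralToFrame     -- ★ p858805 (this seat): the window `exists_nhds_one_v_finGammaTwo_sub_one_le`; brings ★ `v_eq_one_of_mul_map_eq_one`
import Summits.HodgeConjecture.HodgeConjecture.Theorems.F0P3cDyRamLevelsPieceCountDictionary     -- ★ p858704 (LH4-p06 (g6)): (D-G) `pieceCountDictionary_levels (a b)`, `pieceCountDictionary_sqLevel (b)`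
import Summits.HodgeConjecture.HodgeConjecture.Theorems.F0P3cDyRamFourFrameHSideDefsR            -- ★ DEFS №2c-R: (D-CΔ)-S `FourFrameTransferFactorS shift N₀`
import HarnessLib

/-!
# Crux `H413`, line LH4 «(D-RAM) FOUR-FRAME» — THE (J) SOCKET IN FRAME CURRENCY FOR THE CONGRUENCE-LEVEL PIECES `𝟙_{K_{a,b}}` AND `𝟙{u ∈ K ∣ X² ∈ ϖ^b M₃}`:
# their three population rows from (D-CΔ)-S and an H-side realisation of the κ-signed LEVEL CENSUS OVER THE FOUR FRAMES `Γ_b` (dictionary ★ p858704 discharged inside)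

Cell `hodgecm-mathlib` (D-0151), FLOOR 0, crux item H413 = `stmt-HodgeConjecture-24833`, route of record `HCCMUnconditional`; squad F0∕P3c∕LH4 (req618∕req620); dealer
LH4-plan (g12) WORD #40 «(J-lev-frame)» (board §3); helper lane `--supports stmt-HodgeConjecture-24833 --as helper` (count-neutral).  THEOREMS ONLY (two theorems; no `def`,
no instance, no notation, no `sorry`, default heartbeats).  A SOCKET IS LAW-FREE PLUMBING: nothing here states or proves a census law; it pays no tier-0 row.

WHY (STAGE-1b; LEAD T19-24 scoping lane).  By ★ p858649 (F0P3a-p01 (g35)) the open tier-0 rows `stub_rows_transvMinus ∕ regular` reduce to rows of `f_{T+}`, of `1_K` (★) and of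
the CONGRUENCE-LEVEL PIECES `𝟙_{K_{a,b}} = 𝟙{u ∈ K ∣ X ∈ ϖ^a M₃ ∧ X² ∈ ϖ^b M₃}` (`(a, b) ∈ {(ℓ₀, m*), (ℓ₀+1, m*)}`, `pieceRowsWild_shell_of_levels`) and `𝟙{u ∈ K ∣ X² ∈ ϖ^{m*} M₃}`
(`pieceRowsWild_gselStar_three_of`), `X = ι_w u − 1`; their (D-G) dictionaries are ★ p858704 (LH4-p06 (g6)) for ARBITRARY level schedules `a b`.  THIS FILE is the (J) socket for
exactly those pieces, in the currency a frame-level census LAW would be typed in: GIVEN (D-CΔ)-S at any schedule `(shift, N₀)` (★ `fourFrameTransferFactorS_any`) and, at every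
wild place (datum `(d, t_E)`, skew `δ`, `[Fintype 𝓀_w]`), ONE smooth finite `H`-family `ψ` with coefficients whose ROW (1) realises, for `G`-regular `γ_H` near `1` and every literal
package of (D-CΔ)-S, `Δ‴(γ_H, t_{b₀}) · νG₃(K) · Σ_b κ_i(b) · #{M ∣ type-0 vertex, Γ_b·M = M, (Γ_b − 1)·M ⊆ ϖ^a M, (Γ_b − 1)²·M ⊆ ϖ^b M}` — the κ-SIGNED LEVEL CENSUS OVER THE
FOUR FRAMES — and whose ROWS (2)(3) are the piece's type-(2) ∕ Levi rows, THEN `PieceRowsWild ‹𝟙_{K_{a,b}}› 0` (the `hA`∕`hB` hypotheses of ★ `pieceRowsWild_shell_of_levels` at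
`(a, b) = (ℓ₀, m*), (ℓ₀+1, m*)` token for token); likewise for the square-level piece (the `hSq` hypothesis of ★ `pieceRowsWild_gselStar_three_of` at `b = m*`).  PROOF = ★ p858674
`pieceRowsWild_of_signedCensus` (any piece ∕ count, LITERAL currency) fed with ★ p858704's dictionary, the literal-currency H-side triple being manufactured from the frame-currency
one by intersecting `V` with the window `|γ₂(γ_H)_w − 1| ≤ |ϖ|^{a+b}` (resp. `|ϖ|^b`) of ★ p858805 and rewriting each literal count `#{…}(ι_w t_b) = #{…}(Γ_b)` by ★ p858792
(`ι_w t_b = z·Γ_b`, `|z| = 1` as `z·σ_w z = 1`).  `a, b` are schedules `(L, v, w) ↦ ℕ` exactly as in ★ `pieceCountDictionary_levels`.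

WHAT IS PROVED.
* `pieceRowsWild_levels_of_frameSignedCensus (shift) (N₀) (la lb) (hDΔ) (hDH_frames) : PieceRowsWild ‹𝟙_{K_{la,lb}}› 0`.
* `pieceRowsWild_sqLevel_of_frameSignedCensus (shift) (N₀) (lb) (hDΔ) (hDH_frames) : PieceRowsWild ‹𝟙{u ∈ K ∣ X² ∈ ϖ^{lb} M₃}› 0`.
HONEST LABEL.  Count-neutral (`--supports`): pays no registered stub, touches no `Lines/` module, states no census law; tier-0 rows T₊∕T₋∕reg stay OPEN until the (L-lev)∕(H-lev)
producers exist; `HC_CM` is proved only modulo the 7 printed citations (2 remaining named inputs: hLiu418 = `stmt-HodgeConjecture-24832`, h413 = `stmt-HodgeConjecture-24833`)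
until rung 0 closes.

## References
* [Rogawski1990] J. D. Rogawski, *Automorphic Representations of Unitary Groups in Three Variables*, Ann. of Math. Stud. 123 (1990): §4.9 Prop. 4.9.1 (a)(b) p. 55, Lemma 4.9.3 p. 56.
* [LanglandsShelstad1987] R. P. Langlands, D. Shelstad, *On the definition of transfer factors*, Math. Ann. 278 (1987), §1.3, §3.
* [Kottwitz1986BaseChangeUnits] R. E. Kottwitz, *Base change for unit elements of Hecke algebras*, Compositio Math. 60 (1986), §1 pp. 240–241.
-/

set_option autoImplicit false

noncomputable section

namespace Summit.HodgeConjecture.HodgeConjecture.Cruxes.H413.F0P3cDyRamPieceRowsLevelsOfFrameSignedCensus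

open MeasureTheory Measure NumberField IsDedekindDomain Topology Filter
open Literature.NumberTheory.Automorphic Literature.NumberTheory.Automorphic.UnitaryGroup Literature.NumberTheory.Automorphic.IntegralReduction
open Literature.NumberTheory.Automorphic.UnitaryLatticeTree Literature.NumberTheory.Automorphic.HermitianLattice
open Literature.NumberTheory.Rogawski1990 Literature.NumberTheory.GaloisRepresentations
open Literature.MeasureTheory.Group (descConj)
open Literature.NumberTheory.Automorphic.UnitaryThreeFourFrame
open scoped Matrix MatrixGroups Classical ValuativeRel WithZero
open Summit.HodgeConjecture.HodgeConjecture.Cruxes.H413.F0P3cDyRamFourFrameLawDefs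
open Summit.HodgeConjecture.HodgeConjecture.Cruxes.H413.F0P3cDyRamFourFrameLawDefsR
open Summit.HodgeConjecture.HodgeConjecture.Cruxes.H413.F0P3cDyRamFourFrameHSideDefs
open Summit.HodgeConjecture.HodgeConjecture.Cruxes.H413.F0P3cDyRamFourFrameHSideDefsR
open Summit.HodgeConjecture.HodgeConjecture.Cruxes.H413.F0P3cDyRamFourFramePieces
open Summit.HodgeConjecture.HodgeConjecture.Cruxes.H413.F0P3cDyRamFourFrameCensusDefs
open Summit.HodgeConjecture.HodgeConjecture.Cruxes.H413.F0P3cDyRamPieceRowsOfSignedCensus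
open Summit.HodgeConjecture.HodgeConjecture.Cruxes.H413.F0P3cDyRamProfileCountCentralRescaling
open Summit.HodgeConjecture.HodgeConjecture.Cruxes.H413.F0P3cDyRamLevelCountCentralRescaling
open Summit.HodgeConjecture.HodgeConjecture.Cruxes.H413.F0P3cDyRamSignedCensusLiteralToFrame
open Summit.HodgeConjecture.HodgeConjecture.Cruxes.H413.F0P3cDyRamLevelsPieceCountDictionary

set_option maxHeartbeats 400000 in
/-- **THE (J) SOCKET IN FRAME CURRENCY FOR THE LEVEL PIECE `𝟙_{K_{a,b}}`** (schedules `la lb : (L, v, w) ↦ ℕ` as in ★ `pieceCountDictionary_levels`): GIVEN (D-CΔ)-S at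
`(shift, N₀)` and an H-side triple whose ROW (1) realises `Δ‴(γ_H, t_{b₀}) · νG₃(K) · Σ_b κ_i(b)·#{M ∣ type-0, Γ_b·M = M, (Γ_b−1)·M ⊆ ϖ^{la}M, (Γ_b−1)²·M ⊆ ϖ^{lb}M}` (FRAME currency)
and whose ROWS (2)(3) are the piece's type-(2) ∕ Levi rows, THEN `PieceRowsWild ‹𝟙_{K_{la,lb}}› 0` — the `hA`∕`hB` slot of ★ `pieceRowsWild_shell_of_levels` at
`(la, lb) = (ℓ₀, m*), (ℓ₀+1, m*)`.  Proof: ★ p858674 over ★ `pieceCountDictionary_levels la lb`, window ★ p858805 at `ϖ^{la+lb}`, literal ↦ frame by ★ `ncard_levels_eq_of_coe_eq_smul`.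
[cite: Rogawski1990, §4.9 Prop. 4.9.1 (a)(b) p. 55] [cite: LanglandsShelstad1987, §1.3, §3] [cite: Kottwitz1986BaseChangeUnits, §1 pp. 240–241] -/
theorem pieceRowsWild_levels_of_frameSignedCensus (shift : ℕ → ℕ → ℤ) (N₀ : ℕ → ℕ) (la lb : (∀ (L : Type) [Field L] [NumberField L] [IsCMField L] (v : HeightOneSpectrum (𝓞 ↥(maximalRealSubfield L))), UnitaryGroup.PlacesOver L v → ℕ))
    (hDΔ : FourFrameTransferFactorS shift N₀)
    (hDH :
      ∀ (L : Type) [Field L] [NumberField L] [IsCMField L]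
        {v : HeightOneSpectrum (𝓞 ↥(maximalRealSubfield L))} (w : UnitaryGroup.PlacesOver L v)
        (hw : IsCMField.complexConj L • w.1 = w.1) (_he : v.asIdeal.ramificationIdx' w.1.asIdeal ≠ 1)
        (_h2 : ¬ IsUnit (2 : 𝒪[w.1.adicCompletion L]))
        (ϖ : (w.1.adicCompletion L)) (_hϖ : Valued.v ϖ = WithZero.exp (-1 : ℤ)) (d tE : ℕ) (_hD : IsRamifiedQuadraticDatum (galAdicCompletionMap (L := L) (IsCMField.complexConj L) hw) ϖ d tE)
        [Fintype (Valued.ResidueField (w.1.adicCompletion L))] (δ : (w.1.adicCompletion L)) (_hδ : (galAdicCompletionMap (L := L) (IsCMField.complexConj L) hw) δ = -δ) (_hδ0 : δ ≠ 0)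
        (μ : HeckeCharacter L) (_hμu : μ.IsUnitary)
        (_hμω : ∀ x : ideleGroup ↥(maximalRealSubfield L), μ (AdeleRing.ideleBaseChange ↥(maximalRealSubfield L) L x) = quadraticHeckeCharCM L x)
        [MeasurableSpace ((UnitaryGroup.cmDatum L 3 (Matrix.of fun i j : Fin 3 => if i.val + j.val + 1 = 3 then (1 : L) else 0)).Local v)] [BorelSpace ((UnitaryGroup.cmDatum L 3 (Matrix.of fun i j : Fin 3 => if i.val + j.val + 1 = 3 then (1 : L) else 0)).Local v)]
        [∀ γ : ((UnitaryGroup.cmDatum L 3 (Matrix.of fun i j : Fin 3 => if i.val + j.val + 1 = 3 then (1 : L) else 0)).Local v), MeasurableSpace (((UnitaryGroup.cmDatum L 3 (Matrix.of fun i j : Fin 3 => if i.val + j.val + 1 = 3 then (1 : L) else 0)).Local v) ⧸ Subgroup.centralizer ({γ} : Set ((UnitaryGroup.cmDatum L 3 (Matrix.of fun i j : Fin 3 => if i.val + j.val + 1 = 3 then (1 : L) else 0)).Local v)))]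
        [∀ γ : ((UnitaryGroup.cmDatum L 3 (Matrix.of fun i j : Fin 3 => if i.val + j.val + 1 = 3 then (1 : L) else 0)).Local v), BorelSpace (((UnitaryGroup.cmDatum L 3 (Matrix.of fun i j : Fin 3 => if i.val + j.val + 1 = 3 then (1 : L) else 0)).Local v) ⧸ Subgroup.centralizer ({γ} : Set ((UnitaryGroup.cmDatum L 3 (Matrix.of fun i j : Fin 3 => if i.val + j.val + 1 = 3 then (1 : L) else 0)).Local v)))]
        [MeasurableSpace ((UnitaryGroup.cmDatum L 2 (Matrix.of fun i j : Fin 2 => if i.val + j.val + 1 = 2 then (1 : L) else 0)).Local v × (UnitaryGroup.cmDatum L 1 (Matrix.of fun i j : Fin 1 => if i.val + j.val + 1 = 1 then (1 : L) else 0)).Local v)] [BorelSpace ((UnitaryGroup.cmDatum L 2 (Matrix.of fun i j : Fin 2 => if i.val + j.val + 1 = 2 then (1 : L) else 0)).Local v × (UnitaryGroup.cmDatum L 1 (Matrix.of fun i j : Fin 1 => if i.val + j.val + 1 = 1 then (1 : L) else 0)).Local v)]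
        [∀ a : ((UnitaryGroup.cmDatum L 2 (Matrix.of fun i j : Fin 2 => if i.val + j.val + 1 = 2 then (1 : L) else 0)).Local v × (UnitaryGroup.cmDatum L 1 (Matrix.of fun i j : Fin 1 => if i.val + j.val + 1 = 1 then (1 : L) else 0)).Local v), MeasurableSpace (((UnitaryGroup.cmDatum L 2 (Matrix.of fun i j : Fin 2 => if i.val + j.val + 1 = 2 then (1 : L) else 0)).Local v × (UnitaryGroup.cmDatum L 1 (Matrix.of fun i j : Fin 1 => if i.val + j.val + 1 = 1 then (1 : L) else 0)).Local v) ⧸ Subgroup.centralizer ({a} : Set ((UnitaryGroup.cmDatum L 2 (Matrix.of fun i j : Fin 2 => if i.val + j.val + 1 = 2 then (1 : L) else 0)).Local v × (UnitaryGroup.cmDatum L 1 (Matrix.of fun i j : Fin 1 => if i.val + j.val + 1 = 1 then (1 : L) else 0)).Local v)))]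
        [∀ a : ((UnitaryGroup.cmDatum L 2 (Matrix.of fun i j : Fin 2 => if i.val + j.val + 1 = 2 then (1 : L) else 0)).Local v × (UnitaryGroup.cmDatum L 1 (Matrix.of fun i j : Fin 1 => if i.val + j.val + 1 = 1 then (1 : L) else 0)).Local v), BorelSpace (((UnitaryGroup.cmDatum L 2 (Matrix.of fun i j : Fin 2 => if i.val + j.val + 1 = 2 then (1 : L) else 0)).Local v × (UnitaryGroup.cmDatum L 1 (Matrix.of fun i j : Fin 1 => if i.val + j.val + 1 = 1 then (1 : L) else 0)).Local v) ⧸ Subgroup.centralizer ({a} : Set ((UnitaryGroup.cmDatum L 2 (Matrix.of fun i j : Fin 2 => if i.val + j.val + 1 = 2 then (1 : L) else 0)).Local v × (UnitaryGroup.cmDatum L 1 (Matrix.of fun i j : Fin 1 => if i.val + j.val + 1 = 1 then (1 : L) else 0)).Local v)))]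
        (νH : Measure ((UnitaryGroup.cmDatum L 2 (Matrix.of fun i j : Fin 2 => if i.val + j.val + 1 = 2 then (1 : L) else 0)).Local v × (UnitaryGroup.cmDatum L 1 (Matrix.of fun i j : Fin 1 => if i.val + j.val + 1 = 1 then (1 : L) else 0)).Local v)) [νH.IsHaarMeasure] [νH.IsMulRightInvariant]
        (νG₃ : Measure ((UnitaryGroup.cmDatum L 3 (Matrix.of fun i j : Fin 3 => if i.val + j.val + 1 = 3 then (1 : L) else 0)).Local v)) [νG₃.IsHaarMeasure] [νG₃.IsMulRightInvariant]
        (mH : OrbitalMeasureFamily ((UnitaryGroup.cmDatum L 2 (Matrix.of fun i j : Fin 2 => if i.val + j.val + 1 = 2 then (1 : L) else 0)).Local v × (UnitaryGroup.cmDatum L 1 (Matrix.of fun i j : Fin 1 => if i.val + j.val + 1 = 1 then (1 : L) else 0)).Local v)) (mG₃ : OrbitalMeasureFamily ((UnitaryGroup.cmDatum L 3 (Matrix.of fun i j : Fin 3 => if i.val + j.val + 1 = 3 then (1 : L) else 0)).Local v))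
        (_hmH : mH.IsCanonical (IsLocalGRegular L v) νH) (_hmG : mG₃.IsCanonical (fun γ => IsRegularElt (γ.val : GL (Fin 3) (UnitaryGroup.LocalRing L v))) νG₃),
        ∃ (r : ℕ) (ψ : Fin r → ((UnitaryGroup.cmDatum L 2 (Matrix.of fun i j : Fin 2 => if i.val + j.val + 1 = 2 then (1 : L) else 0)).Local v × (UnitaryGroup.cmDatum L 1 (Matrix.of fun i j : Fin 1 => if i.val + j.val + 1 = 1 then (1 : L) else 0)).Local v) → ℂ) (_ : ∀ s, IsLocSmooth (ψ s)) (coef : Fin r → ℂ),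
          -- ROW (1): the H-side realises THE κ-SIGNED LEVEL CENSUS OVER THE FOUR FRAMES `Γ_b` times the base transfer factor (no law pre-evaluated)
          (∃ V ∈ 𝓝 (1 : ((UnitaryGroup.cmDatum L 2 (Matrix.of fun i j : Fin 2 => if i.val + j.val + 1 = 2 then (1 : L) else 0)).Local v × (UnitaryGroup.cmDatum L 1 (Matrix.of fun i j : Fin 1 => if i.val + j.val + 1 = 1 then (1 : L) else 0)).Local v)), ∀ γH ∈ V, IsLocalGRegular L v γH →
            ∀ (f : Fin 4 → Fin 3 → (Fin 3 → (w.1.adicCompletion L))) (_hf : IsFourFrameFamily (galAdicCompletionMap (L := L) (IsCMField.complexConj L) hw) f)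
          (a b z : (w.1.adicCompletion L)) (_ha : a * (galAdicCompletionMap (L := L) (IsCMField.complexConj L) hw) a = 1) (_hb : b * (galAdicCompletionMap (L := L) (IsCMField.complexConj L) hw) b = 1) (_hz : z * (galAdicCompletionMap (L := L) (IsCMField.complexConj L) hw) z = 1)
          (_hzγ : z = finGammaTwo L v γH w) (_hra : ((((γH).1.val : GL (Fin 2) (UnitaryGroup.LocalRing L v)).val.map (Pi.evalRingHom (fun w' : UnitaryGroup.PlacesOver L v => w'.1.adicCompletion L) w))).charpoly.IsRoot (z * (a * a))) (_hrb : ((((γH).1.val : GL (Fin 2) (UnitaryGroup.LocalRing L v)).val.map (Pi.evalRingHom (fun w' : UnitaryGroup.PlacesOver L v => w'.1.adicCompletion L) w))).charpoly.IsRoot (z * (b * b)))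
          (_ha1 : Valued.v (a - 1) < Valued.v (2 : (w.1.adicCompletion L))) (_hb1 : Valued.v (b - 1) < Valued.v (2 : (w.1.adicCompletion L)))
          (n₁ n₂ n₃ : ℕ) (_hE : IsElementDatum (galAdicCompletionMap (L := L) (IsCMField.complexConj L) hw) ϖ (N₀ d) (a * a) (b * b) n₁ n₂ n₃)
          (k : ℕ) (_hk : 2 * k + d = n₁ + n₂ + n₃ + 2)
          (Γ : Fin 4 → GL (Fin 3) (w.1.adicCompletion L)) (_hΓ : ∀ b', (Γ b' : Matrix (Fin 3) (Fin 3) (w.1.adicCompletion L)) = frameElt (galAdicCompletionMap (L := L) (IsCMField.complexConj L) hw) f b' (a * a) (b * b))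
          (tb : Fin 4 → ((UnitaryGroup.cmDatum L 3 (Matrix.of fun i j : Fin 3 => if i.val + j.val + 1 = 3 then (1 : L) else 0)).Local v)) (_htb : ∀ b', ((((localNonsplitEquiv (IsCMField.complexConj L) (Matrix.of fun i j : Fin 3 => if i.val + j.val + 1 = 3 then (1 : L) else 0) (IsCMField.complexConj_ne_one L) w hw (tb b') :
                ↥(unitaryGroupOfForm (galAdicCompletionMap (L := L) (IsCMField.complexConj L) hw) (placeForm (Matrix.of fun i j : Fin 3 => if i.val + j.val + 1 = 3 then (1 : L) else 0) w.1))) : GL (Fin 3) (w.1.adicCompletion L)) : Matrix (Fin 3) (Fin 3) (w.1.adicCompletion L))) = z • (Γ b' : Matrix (Fin 3) (Fin 3) (w.1.adicCompletion L)))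
              (i : Fin 3) (B : ℤ), 2 * B = ((![n₁, n₂, n₃] : Fin 3 → ℕ) i : ℤ) - d + 2 - 2 * shift d tE →
              (∀ t' : ((UnitaryGroup.cmDatum L 3 (Matrix.of fun i j : Fin 3 => if i.val + j.val + 1 = 3 then (1 : L) else 0)).Local v), IsLocalNormPair L (Matrix.of fun i j : Fin 3 => if i.val + j.val + 1 = 3 then (1 : L) else 0) v γH t' ↔ ∃ b', ConjClasses.mk t' = ConjClasses.mk (tb b')) →
              (∀ b' : Fin 4, ((finExplicitCollection L (Matrix.of fun i j : Fin 3 => if i.val + j.val + 1 = 3 then (1 : L) else 0) μ (finExplicitDelta_conj_left_all L (Matrix.of fun i j : Fin 3 => if i.val + j.val + 1 = 3 then (1 : L) else 0) μ) (finExplicitDelta_conj_right_all L (Matrix.of fun i j : Fin 3 => if i.val + j.val + 1 = 3 then (1 : L) else 0) μ)) v).Δ γH (tb b') = ((finExplicitCollection L (Matrix.of fun i j : Fin 3 => if i.val + j.val + 1 = 3 then (1 : L) else 0) μ (finExplicitDelta_conj_left_all L (Matrix.of fun i j : Fin 3 => if i.val + j.val + 1 = 3 then (1 : L) else 0) μ)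 (finExplicitDelta_conj_right_all L (Matrix.of fun i j : Fin 3 => if i.val + j.val + 1 = 3 then (1 : L) else 0) μ)) v).Δ γH (tb 0) * (kappaChar i b' : ℂ)) →
              ∑ s, coef s * stableOrbitalIntegralRel (IsLocalStablyConjH L v) mH (ψ s) γH =
                ((finExplicitCollection L (Matrix.of fun i j : Fin 3 => if i.val + j.val + 1 = 3 then (1 : L) else 0) μ (finExplicitDelta_conj_left_all L (Matrix.of fun i j : Fin 3 => if i.val + j.val + 1 = 3 then (1 : L) else 0) μ) (finExplicitDelta_conj_right_all L (Matrix.of fun i j : Fin 3 => if i.val + j.val + 1 = 3 then (1 : L) else 0) μ)) v).Δ γH (tb 0) * ((νG₃ (cmLocalIntegralLevel L 3 (Matrix.of fun i j : Fin 3 => if i.val + j.val + 1 = 3 then (1 : L) else 0) v : Set ((UnitaryGroup.cmDatum L 3 (Matrix.of fun i j : Fin 3 => if i.val + j.val + 1 = 3 then (1 : L) else 0)).Local v))).toReal : ℂ) *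
                  ∑ b' : Fin 4, (kappaChar i b' : ℂ) * 
                    ({M : Submodule (Valued.integer (w.1.adicCompletion L)) (Fin 3 → w.1.adicCompletion L) |
                      IsVertexLattice (galAdicCompletionMap (L := L) (IsCMField.complexConj L) hw) ϖ ((StdForm.antidiagonal 3).over (w.1.adicCompletion L)) 0 M ∧ mapGL (Γ b') M = M ∧
                        (LatticeInLevel ϖ (la L v w) ((Γ b' : Matrix (Fin 3) (Fin 3) (w.1.adicCompletion L)) - 1) M ∧
                          LatticeInLevel ϖ (lb L v w) (((Γ b' : Matrix (Fin 3) (Fin 3) (w.1.adicCompletion L)) - 1) * ((Γ b' : Matrix (Fin 3) (Fin 3) (w.1.adicCompletion L)) - 1)) M)}.ncard : ℂ)) ∧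
          -- ROW (2), type (2), transfer-shaped (law debt)
          (∃ V ∈ 𝓝 (1 : ((UnitaryGroup.cmDatum L 2 (Matrix.of fun i j : Fin 2 => if i.val + j.val + 1 = 2 then (1 : L) else 0)).Local v × (UnitaryGroup.cmDatum L 1 (Matrix.of fun i j : Fin 1 => if i.val + j.val + 1 = 1 then (1 : L) else 0)).Local v)), ∀ γH ∈ V, IsLocalGRegular L v γH →
          ¬ (∃ x : (w.1.adicCompletion L), (((((γH).1.val : GL (Fin 2) (UnitaryGroup.LocalRing L v)).val.map (Pi.evalRingHom (fun w' : UnitaryGroup.PlacesOver L v => w'.1.adicCompletion L) w))).charpoly).IsRoot x) →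
          ∑ᶠ c : ConjClasses ((UnitaryGroup.cmDatum L 3 (Matrix.of fun i j : Fin 3 => if i.val + j.val + 1 = 3 then (1 : L) else 0)).Local v), ((finExplicitCollection L (Matrix.of fun i j : Fin 3 => if i.val + j.val + 1 = 3 then (1 : L) else 0) μ (finExplicitDelta_conj_left_all L (Matrix.of fun i j : Fin 3 => if i.val + j.val + 1 = 3 then (1 : L) else 0) μ) (finExplicitDelta_conj_right_all L (Matrix.of fun i j : Fin 3 => if i.val + j.val + 1 = 3 then (1 : L) else 0) μ)) v).Δ γH (Quotient.out c) * classOrbitalIntegral mG₃ 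
            (Set.indicator {u : ((UnitaryGroup.cmDatum L 3 (Matrix.of fun i j : Fin 3 => if i.val + j.val + 1 = 3 then (1 : L) else 0)).Local v) |
            u ∈ cmLocalIntegralLevel L 3 (Matrix.of fun i j : Fin 3 => if i.val + j.val + 1 = 3 then (1 : L) else 0) v ∧
            (InLevel ϖ (la L v w) (wMatrix L w hw u - 1) ∧ InLevel ϖ (lb L v w) ((wMatrix L w hw u - 1) * (wMatrix L w hw u - 1)))} (fun _ => (1 : ℂ))) c =
            ∑ s, coef s * stableOrbitalIntegralRel (IsLocalStablyConjH L v) mH (ψ s) γH) ∧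
          -- ROW (3), Levi, transfer-shaped (law debt)
          (∃ V ∈ 𝓝 (1 : ((UnitaryGroup.cmDatum L 2 (Matrix.of fun i j : Fin 2 => if i.val + j.val + 1 = 2 then (1 : L) else 0)).Local v × (UnitaryGroup.cmDatum L 1 (Matrix.of fun i j : Fin 1 => if i.val + j.val + 1 = 1 then (1 : L) else 0)).Local v)), ∀ γH ∈ V, IsLocalGRegular L v γH →
          (∃ (y : ((UnitaryGroup.cmDatum L 2 (Matrix.of fun i j : Fin 2 => if i.val + j.val + 1 = 2 then (1 : L) else 0)).Local v × (UnitaryGroup.cmDatum L 1 (Matrix.of fun i j : Fin 1 => if i.val + j.val + 1 = 1 then (1 : L) else 0)).Local v)) (d' : Fin 2 → (UnitaryGroup.LocalRing L v)ˣ),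
              glDiagonal 2 (UnitaryGroup.LocalRing L v) d' = ((y * γH * y⁻¹).1.val : GL (Fin 2) (UnitaryGroup.LocalRing L v))) →
          ∑ᶠ c : ConjClasses ((UnitaryGroup.cmDatum L 3 (Matrix.of fun i j : Fin 3 => if i.val + j.val + 1 = 3 then (1 : L) else 0)).Local v), ((finExplicitCollection L (Matrix.of fun i j : Fin 3 => if i.val + j.val + 1 = 3 then (1 : L) else 0) μ (finExplicitDelta_conj_left_all L (Matrix.of fun i j : Fin 3 => if i.val + j.val + 1 = 3 then (1 : L) else 0) μ) (finExplicitDelta_conj_right_all L (Matrix.of fun i j : Fin 3 => if i.val + j.val + 1 = 3 then (1 : L) else 0) μ)) v).Δ γH (Quotient.out c) * classOrbitalIntegral mG₃ 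
            (Set.indicator {u : ((UnitaryGroup.cmDatum L 3 (Matrix.of fun i j : Fin 3 => if i.val + j.val + 1 = 3 then (1 : L) else 0)).Local v) |
            u ∈ cmLocalIntegralLevel L 3 (Matrix.of fun i j : Fin 3 => if i.val + j.val + 1 = 3 then (1 : L) else 0) v ∧
            (InLevel ϖ (la L v w) (wMatrix L w hw u - 1) ∧ InLevel ϖ (lb L v w) ((wMatrix L w hw u - 1) * (wMatrix L w hw u - 1)))} (fun _ => (1 : ℂ))) c =
            ∑ s, coef s * stableOrbitalIntegralRel (IsLocalStablyConjH L v) mH (ψ s) γH)) :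
    PieceRowsWild
      (fun _ : Fin 1 => fun (L : Type) [Field L] [NumberField L] [IsCMField L] (v : HeightOneSpectrum (𝓞 ↥(maximalRealSubfield L))) (w : UnitaryGroup.PlacesOver L v)
          (hw : IsCMField.complexConj L • w.1 = w.1) (ϖ : w.1.adicCompletion L) =>
        Set.indicator {u : ((UnitaryGroup.cmDatum L 3 (Matrix.of fun i j : Fin 3 => if i.val + j.val + 1 = 3 then (1 : L) else 0)).Local v) |
            u ∈ cmLocalIntegralLevel L 3 (Matrix.of fun i j : Fin 3 => if i.val + j.val + 1 = 3 then (1 : L) else 0) v ∧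
            (InLevel ϖ (la L v w) (wMatrix L w hw u - 1) ∧ InLevel ϖ (lb L v w) ((wMatrix L w hw u - 1) * (wMatrix L w hw u - 1)))} (fun _ => (1 : ℂ))) 0 := by
  refine pieceRowsWild_of_signedCensus shift N₀
    (fun _ : Fin 1 => fun (L : Type) [Field L] [NumberField L] [IsCMField L] (v : HeightOneSpectrum (𝓞 ↥(maximalRealSubfield L))) (w : UnitaryGroup.PlacesOver L v)
          (hw : IsCMField.complexConj L • w.1 = w.1) (ϖ : w.1.adicCompletion L) =>
        Set.indicator {u : ((UnitaryGroup.cmDatum L 3 (Matrix.of fun i j : Fin 3 => if i.val + j.val + 1 = 3 then (1 : L) else 0)).Local v) |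
            u ∈ cmLocalIntegralLevel L 3 (Matrix.of fun i j : Fin 3 => if i.val + j.val + 1 = 3 then (1 : L) else 0) v ∧
            (InLevel ϖ (la L v w) (wMatrix L w hw u - 1) ∧ InLevel ϖ (lb L v w) ((wMatrix L w hw u - 1) * (wMatrix L w hw u - 1)))} (fun _ => (1 : ℂ)))
    0
    (fun (L : Type) [Field L] [NumberField L] [IsCMField L] (v : HeightOneSpectrum (𝓞 ↥(maximalRealSubfield L))) (w : UnitaryGroup.PlacesOver L v)
          (hw : IsCMField.complexConj L • w.1 = w.1) (ϖ : w.1.adicCompletion L) (T : GL (Fin 3) (w.1.adicCompletion L)) =>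
        {M : Submodule (Valued.integer (w.1.adicCompletion L)) (Fin 3 → w.1.adicCompletion L) |
            IsVertexLattice (galAdicCompletionMap (L := L) (IsCMField.complexConj L) hw) ϖ ((StdForm.antidiagonal 3).over (w.1.adicCompletion L)) 0 M ∧ mapGL T M = M ∧
              (LatticeInLevel ϖ (la L v w) ((T : Matrix (Fin 3) (Fin 3) (w.1.adicCompletion L)) - 1) M ∧
                LatticeInLevel ϖ (lb L v w) (((T : Matrix (Fin 3) (Fin 3) (w.1.adicCompletion L)) - 1) * ((T : Matrix (Fin 3) (Fin 3) (w.1.adicCompletion L)) - 1)) M)}.ncard)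
    (pieceCountDictionary_levels la lb) hDΔ ?_
  intro L _i1 _i2 _i3 v w hw he h2 ϖ hϖ d tE hD _iF δ hδ hδ0 μ hμu hμω _i4 _i5 _i6 _i7 _i8 _i9 _i10 _i11 νH _i12 _i13 νG₃ _i14 _i15 mH mG₃ hmH hmG
  obtain ⟨r, ψ, hψ, coef, ⟨VH, hVH, hH⟩, hrow2, hrow3⟩ := hDH L w hw he h2 ϖ hϖ d tE hD δ hδ hδ0 μ hμu hμω νH νG₃ mH mG₃ hmH hmG
  have hvσ : ∀ a, Valued.v ((galAdicCompletionMap (L := L) (IsCMField.complexConj L) hw) a) = Valued.v a := fun a => valued_galAdicCompletionMap (L := L) (IsCMField.complexConj L) hw a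
  have hϖ0 : ϖ ≠ 0 := fun h0 => by rw [h0, map_zero] at hϖ; exact WithZero.coe_ne_zero hϖ.symm
  have hϖ1 : Valued.v ϖ ≤ 1 := by rw [hϖ, ← WithZero.exp_zero]; exact WithZero.exp_le_exp.2 (by norm_num)
  -- the WINDOW `|γ₂(γ_H)_w − 1| ≤ |ϖ|^la L v w + lb L v w` (★ p858805), intersected into `V`
  obtain ⟨Vz, hVz, hzw⟩ := exists_nhds_one_v_finGammaTwo_sub_one_le L w (c := ϖ ^ (la L v w + lb L v w)) (pow_ne_zero _ hϖ0)
  refine ⟨r, ψ, hψ, coef, ⟨VH ∩ Vz, Filter.inter_mem hVH hVz, ?_⟩, hrow2, hrow3⟩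
  intro γH hγ hreg f hf a b z ha hb hz hzγ hra hrb ha1 hb1 n₁ n₂ n₃ hE k hk Γ hΓ tb htb i B hB hNP hrel
  rw [hH γH hγ.1 hreg f hf a b z ha hb hz hzγ hra hrb ha1 hb1 n₁ n₂ n₃ hE k hk Γ hΓ tb htb i B hB hNP hrel]
  have hz1 : Valued.v z = 1 := UnitaryThreeFourFrame.v_eq_one_of_mul_map_eq_one hvσ hz
  have hzm : Valued.v (z - 1) ≤ Valued.v ϖ ^ (la L v w + lb L v w) := by rw [hzγ, ← map_pow]; exact hzw γH hγ.2
  have hza : Valued.v (z - 1) ≤ Valued.v ϖ ^ la L v w := hzm.trans (pow_le_pow_right_of_le_one' hϖ1 (Nat.le_add_right _ _))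
  have hzb : Valued.v (z - 1) ≤ Valued.v ϖ ^ lb L v w := hzm.trans (pow_le_pow_right_of_le_one' hϖ1 (Nat.le_add_left _ _))
  congr 1
  refine Finset.sum_congr rfl fun b' _ => ?_
  rw [ncard_levels_eq_of_coe_eq_smul (galAdicCompletionMap (L := L) (IsCMField.complexConj L) hw) hϖ0 hϖ1 hz1 hza hzb (htb b')]

set_option maxHeartbeats 400000 in
/-- **THE (J) SOCKET IN FRAME CURRENCY FOR THE SQUARE-LEVEL PIECE `𝟙{u ∈ K ∣ X² ∈ ϖ^{lb} M₃}`**: same, with the square-level census `#{M ∣ type-0, Γ_b·M = M,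
(Γ_b−1)²·M ⊆ ϖ^{lb}M}` over the four frames — the `hSq` slot of ★ `pieceRowsWild_gselStar_three_of` at `lb = m*` (regular row) and an ingredient of the shell.  Proof: ★ p858674
over ★ `pieceCountDictionary_sqLevel lb`, window ★ p858805 at `ϖ^{lb}`, literal ↦ frame by ★ `ncard_sqLevel_eq_of_coe_eq_smul`.
[cite: Rogawski1990, §4.9 Prop. 4.9.1 (a)(b) p. 55] [cite: LanglandsShelstad1987, §1.3, §3] [cite: Kottwitz1986BaseChangeUnits, §1 pp. 240–241] -/
theorem pieceRowsWild_sqLevel_of_frameSignedCensus (shift : ℕ → ℕ → ℤ) (N₀ : ℕ → ℕ) (lb : (∀ (L : Type) [Field L] [NumberField L] [IsCMField L] (v : HeightOneSpectrum (𝓞 ↥(maximalRealSubfield L))), UnitaryGroup.PlacesOver L v → ℕ))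
    (hDΔ : FourFrameTransferFactorS shift N₀)
    (hDH :
      ∀ (L : Type) [Field L] [NumberField L] [IsCMField L]
        {v : HeightOneSpectrum (𝓞 ↥(maximalRealSubfield L))} (w : UnitaryGroup.PlacesOver L v)
        (hw : IsCMField.complexConj L • w.1 = w.1) (_he : v.asIdeal.ramificationIdx' w.1.asIdeal ≠ 1)
        (_h2 : ¬ IsUnit (2 : 𝒪[w.1.adicCompletion L]))
        (ϖ : (w.1.adicCompletion L)) (_hϖ : Valued.v ϖ = WithZero.exp (-1 : ℤ)) (d tE : ℕ) (_hD : IsRamifiedQuadraticDatum (galAdicCompletionMap (L := L) (IsCMField.complexConj L) hw) ϖ d tE)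
        [Fintype (Valued.ResidueField (w.1.adicCompletion L))] (δ : (w.1.adicCompletion L)) (_hδ : (galAdicCompletionMap (L := L) (IsCMField.complexConj L) hw) δ = -δ) (_hδ0 : δ ≠ 0)
        (μ : HeckeCharacter L) (_hμu : μ.IsUnitary)
        (_hμω : ∀ x : ideleGroup ↥(maximalRealSubfield L), μ (AdeleRing.ideleBaseChange ↥(maximalRealSubfield L) L x) = quadraticHeckeCharCM L x)
        [MeasurableSpace ((UnitaryGroup.cmDatum L 3 (Matrix.of fun i j : Fin 3 => if i.val + j.val + 1 = 3 then (1 : L) else 0)).Local v)] [BorelSpace ((UnitaryGroup.cmDatum L 3 (Matrix.of fun i j : Fin 3 => if i.val + j.val + 1 = 3 then (1 : L) else 0)).Local v)]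
        [∀ γ : ((UnitaryGroup.cmDatum L 3 (Matrix.of fun i j : Fin 3 => if i.val + j.val + 1 = 3 then (1 : L) else 0)).Local v), MeasurableSpace (((UnitaryGroup.cmDatum L 3 (Matrix.of fun i j : Fin 3 => if i.val + j.val + 1 = 3 then (1 : L) else 0)).Local v) ⧸ Subgroup.centralizer ({γ} : Set ((UnitaryGroup.cmDatum L 3 (Matrix.of fun i j : Fin 3 => if i.val + j.val + 1 = 3 then (1 : L) else 0)).Local v)))]
        [∀ γ : ((UnitaryGroup.cmDatum L 3 (Matrix.of fun i j : Fin 3 => if i.val + j.val + 1 = 3 then (1 : L) else 0)).Local v), BorelSpace (((UnitaryGroup.cmDatum L 3 (Matrix.of fun i j : Fin 3 => if i.val + j.val + 1 = 3 then (1 : L) else 0)).Local v) ⧸ Subgroup.centralizer ({γ} : Set ((UnitaryGroup.cmDatum L 3 (Matrix.of fun i j : Fin 3 => if i.val + j.val + 1 = 3 then (1 : L) else 0)).Local v)))]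
        [MeasurableSpace ((UnitaryGroup.cmDatum L 2 (Matrix.of fun i j : Fin 2 => if i.val + j.val + 1 = 2 then (1 : L) else 0)).Local v × (UnitaryGroup.cmDatum L 1 (Matrix.of fun i j : Fin 1 => if i.val + j.val + 1 = 1 then (1 : L) else 0)).Local v)] [BorelSpace ((UnitaryGroup.cmDatum L 2 (Matrix.of fun i j : Fin 2 => if i.val + j.val + 1 = 2 then (1 : L) else 0)).Local v × (UnitaryGroup.cmDatum L 1 (Matrix.of fun i j : Fin 1 => if i.val + j.val + 1 = 1 then (1 : L) else 0)).Local v)]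
        [∀ a : ((UnitaryGroup.cmDatum L 2 (Matrix.of fun i j : Fin 2 => if i.val + j.val + 1 = 2 then (1 : L) else 0)).Local v × (UnitaryGroup.cmDatum L 1 (Matrix.of fun i j : Fin 1 => if i.val + j.val + 1 = 1 then (1 : L) else 0)).Local v), MeasurableSpace (((UnitaryGroup.cmDatum L 2 (Matrix.of fun i j : Fin 2 => if i.val + j.val + 1 = 2 then (1 : L) else 0)).Local v × (UnitaryGroup.cmDatum L 1 (Matrix.of fun i j : Fin 1 => if i.val + j.val + 1 = 1 then (1 : L) else 0)).Local v) ⧸ Subgroup.centralizer ({a} : Set ((UnitaryGroup.cmDatum L 2 (Matrix.of fun i j : Fin 2 => if i.val + j.val + 1 = 2 then (1 : L) else 0)).Local v × (UnitaryGroup.cmDatum L 1 (Matrix.of fun i j : Fin 1 => if i.val + j.val + 1 = 1 then (1 : L) else 0)).Local v)))]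
        [∀ a : ((UnitaryGroup.cmDatum L 2 (Matrix.of fun i j : Fin 2 => if i.val + j.val + 1 = 2 then (1 : L) else 0)).Local v × (UnitaryGroup.cmDatum L 1 (Matrix.of fun i j : Fin 1 => if i.val + j.val + 1 = 1 then (1 : L) else 0)).Local v), BorelSpace (((UnitaryGroup.cmDatum L 2 (Matrix.of fun i j : Fin 2 => if i.val + j.val + 1 = 2 then (1 : L) else 0)).Local v × (UnitaryGroup.cmDatum L 1 (Matrix.of fun i j : Fin 1 => if i.val + j.val + 1 = 1 then (1 : L) else 0)).Local v) ⧸ Subgroup.centralizer ({a} : Set ((UnitaryGroup.cmDatum L 2 (Matrix.of fun i j : Fin 2 => if i.val + j.val + 1 = 2 then (1 : L) else 0)).Local v × (UnitaryGroup.cmDatum L 1 (Matrix.of fun i j : Fin 1 => if i.val + j.val + 1 = 1 then (1 : L) else 0)).Local v)))]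
        (νH : Measure ((UnitaryGroup.cmDatum L 2 (Matrix.of fun i j : Fin 2 => if i.val + j.val + 1 = 2 then (1 : L) else 0)).Local v × (UnitaryGroup.cmDatum L 1 (Matrix.of fun i j : Fin 1 => if i.val + j.val + 1 = 1 then (1 : L) else 0)).Local v)) [νH.IsHaarMeasure] [νH.IsMulRightInvariant]
        (νG₃ : Measure ((UnitaryGroup.cmDatum L 3 (Matrix.of fun i j : Fin 3 => if i.val + j.val + 1 = 3 then (1 : L) else 0)).Local v)) [νG₃.IsHaarMeasure] [νG₃.IsMulRightInvariant]
        (mH : OrbitalMeasureFamily ((UnitaryGroup.cmDatum L 2 (Matrix.of fun i j : Fin 2 => if i.val + j.val + 1 = 2 then (1 : L) else 0)).Local v × (UnitaryGroup.cmDatum L 1 (Matrix.of fun i j : Fin 1 => if i.val + j.val + 1 = 1 then (1 : L) else 0)).Local v)) (mG₃ : OrbitalMeasureFamily ((UnitaryGroup.cmDatum L 3 (Matrix.of fun i j : Fin 3 => if i.val + j.val + 1 = 3 then (1 : L) else 0)).Local v))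
        (_hmH : mH.IsCanonical (IsLocalGRegular L v) νH) (_hmG : mG₃.IsCanonical (fun γ => IsRegularElt (γ.val : GL (Fin 3) (UnitaryGroup.LocalRing L v))) νG₃),
        ∃ (r : ℕ) (ψ : Fin r → ((UnitaryGroup.cmDatum L 2 (Matrix.of fun i j : Fin 2 => if i.val + j.val + 1 = 2 then (1 : L) else 0)).Local v × (UnitaryGroup.cmDatum L 1 (Matrix.of fun i j : Fin 1 => if i.val + j.val + 1 = 1 then (1 : L) else 0)).Local v) → ℂ) (_ : ∀ s, IsLocSmooth (ψ s)) (coef : Fin r → ℂ),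
          -- ROW (1): the H-side realises THE κ-SIGNED LEVEL CENSUS OVER THE FOUR FRAMES `Γ_b` times the base transfer factor (no law pre-evaluated)
          (∃ V ∈ 𝓝 (1 : ((UnitaryGroup.cmDatum L 2 (Matrix.of fun i j : Fin 2 => if i.val + j.val + 1 = 2 then (1 : L) else 0)).Local v × (UnitaryGroup.cmDatum L 1 (Matrix.of fun i j : Fin 1 => if i.val + j.val + 1 = 1 then (1 : L) else 0)).Local v)), ∀ γH ∈ V, IsLocalGRegular L v γH →
            ∀ (f : Fin 4 → Fin 3 → (Fin 3 → (w.1.adicCompletion L))) (_hf : IsFourFrameFamily (galAdicCompletionMap (L := L) (IsCMField.complexConj L) hw) f)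
          (a b z : (w.1.adicCompletion L)) (_ha : a * (galAdicCompletionMap (L := L) (IsCMField.complexConj L) hw) a = 1) (_hb : b * (galAdicCompletionMap (L := L) (IsCMField.complexConj L) hw) b = 1) (_hz : z * (galAdicCompletionMap (L := L) (IsCMField.complexConj L) hw) z = 1)
          (_hzγ : z = finGammaTwo L v γH w) (_hra : ((((γH).1.val : GL (Fin 2) (UnitaryGroup.LocalRing L v)).val.map (Pi.evalRingHom (fun w' : UnitaryGroup.PlacesOver L v => w'.1.adicCompletion L) w))).charpoly.IsRoot (z * (a * a))) (_hrb : ((((γH).1.val : GL (Fin 2) (UnitaryGroup.LocalRing L v)).val.map (Pi.evalRingHom (fun w' : UnitaryGroup.PlacesOver L v => w'.1.adicCompletion L) w))).charpoly.IsRoot (z * (b * b)))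
          (_ha1 : Valued.v (a - 1) < Valued.v (2 : (w.1.adicCompletion L))) (_hb1 : Valued.v (b - 1) < Valued.v (2 : (w.1.adicCompletion L)))
          (n₁ n₂ n₃ : ℕ) (_hE : IsElementDatum (galAdicCompletionMap (L := L) (IsCMField.complexConj L) hw) ϖ (N₀ d) (a * a) (b * b) n₁ n₂ n₃)
          (k : ℕ) (_hk : 2 * k + d = n₁ + n₂ + n₃ + 2)
          (Γ : Fin 4 → GL (Fin 3) (w.1.adicCompletion L)) (_hΓ : ∀ b', (Γ b' : Matrix (Fin 3) (Fin 3) (w.1.adicCompletion L)) = frameElt (galAdicCompletionMap (L := L) (IsCMField.complexConj L) hw) f b' (a * a) (b * b))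
          (tb : Fin 4 → ((UnitaryGroup.cmDatum L 3 (Matrix.of fun i j : Fin 3 => if i.val + j.val + 1 = 3 then (1 : L) else 0)).Local v)) (_htb : ∀ b', ((((localNonsplitEquiv (IsCMField.complexConj L) (Matrix.of fun i j : Fin 3 => if i.val + j.val + 1 = 3 then (1 : L) else 0) (IsCMField.complexConj_ne_one L) w hw (tb b') :
                ↥(unitaryGroupOfForm (galAdicCompletionMap (L := L) (IsCMField.complexConj L) hw) (placeForm (Matrix.of fun i j : Fin 3 => if i.val + j.val + 1 = 3 then (1 : L) else 0) w.1))) : GL (Fin 3) (w.1.adicCompletion L)) : Matrix (Fin 3) (Fin 3) (w.1.adicCompletion L))) = z • (Γ b' : Matrix (Fin 3) (Fin 3) (w.1.adicCompletion L)))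
              (i : Fin 3) (B : ℤ), 2 * B = ((![n₁, n₂, n₃] : Fin 3 → ℕ) i : ℤ) - d + 2 - 2 * shift d tE →
              (∀ t' : ((UnitaryGroup.cmDatum L 3 (Matrix.of fun i j : Fin 3 => if i.val + j.val + 1 = 3 then (1 : L) else 0)).Local v), IsLocalNormPair L (Matrix.of fun i j : Fin 3 => if i.val + j.val + 1 = 3 then (1 : L) else 0) v γH t' ↔ ∃ b', ConjClasses.mk t' = ConjClasses.mk (tb b')) →
              (∀ b' : Fin 4, ((finExplicitCollection L (Matrix.of fun i j : Fin 3 => if i.val + j.val + 1 = 3 then (1 : L) else 0) μ (finExplicitDelta_conj_left_all L (Matrix.of fun i j : Fin 3 => if i.val + j.val + 1 = 3 then (1 : L) else 0) μ) (finExplicitDelta_conj_right_all L (Matrix.of fun i j : Fin 3 => if i.val + j.val + 1 = 3 then (1 : L) else 0) μ)) v).Δ γH (tb b') = ((finExplicitCollection L (Matrix.of fun i j : Fin 3 => if i.val + j.val + 1 = 3 then (1 : L) else 0) μ (finExplicitDelta_conj_left_all L (Matrix.of fun i j : Fin 3 => if i.val + j.val + 1 = 3 then (1 : L) else 0) μ)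 (finExplicitDelta_conj_right_all L (Matrix.of fun i j : Fin 3 => if i.val + j.val + 1 = 3 then (1 : L) else 0) μ)) v).Δ γH (tb 0) * (kappaChar i b' : ℂ)) →
              ∑ s, coef s * stableOrbitalIntegralRel (IsLocalStablyConjH L v) mH (ψ s) γH =
                ((finExplicitCollection L (Matrix.of fun i j : Fin 3 => if i.val + j.val + 1 = 3 then (1 : L) else 0) μ (finExplicitDelta_conj_left_all L (Matrix.of fun i j : Fin 3 => if i.val + j.val + 1 = 3 then (1 : L) else 0) μ) (finExplicitDelta_conj_right_all L (Matrix.of fun i j : Fin 3 => if i.val + j.val + 1 = 3 then (1 : L) else 0) μ)) v).Δ γH (tb 0) * ((νG₃ (cmLocalIntegralLevel L 3 (Matrix.of fun i j : Fin 3 => if i.val + j.val + 1 = 3 then (1 : L) else 0) v : Set ((UnitaryGroup.cmDatum L 3 (Matrix.of fun i j : Fin 3 => if i.val + j.val + 1 = 3 then (1 : L) else 0)).Local v))).toReal : ℂ) *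
                  ∑ b' : Fin 4, (kappaChar i b' : ℂ) * 
                    ({M : Submodule (Valued.integer (w.1.adicCompletion L)) (Fin 3 → w.1.adicCompletion L) |
                      IsVertexLattice (galAdicCompletionMap (L := L) (IsCMField.complexConj L) hw) ϖ ((StdForm.antidiagonal 3).over (w.1.adicCompletion L)) 0 M ∧ mapGL (Γ b') M = M ∧
                        LatticeInLevel ϖ (lb L v w) (((Γ b' : Matrix (Fin 3) (Fin 3) (w.1.adicCompletion L)) - 1) * ((Γ b' : Matrix (Fin 3) (Fin 3) (w.1.adicCompletion L)) - 1)) M}.ncard : ℂ)) ∧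
          -- ROW (2), type (2), transfer-shaped (law debt)
          (∃ V ∈ 𝓝 (1 : ((UnitaryGroup.cmDatum L 2 (Matrix.of fun i j : Fin 2 => if i.val + j.val + 1 = 2 then (1 : L) else 0)).Local v × (UnitaryGroup.cmDatum L 1 (Matrix.of fun i j : Fin 1 => if i.val + j.val + 1 = 1 then (1 : L) else 0)).Local v)), ∀ γH ∈ V, IsLocalGRegular L v γH →
          ¬ (∃ x : (w.1.adicCompletion L), (((((γH).1.val : GL (Fin 2) (UnitaryGroup.LocalRing L v)).val.map (Pi.evalRingHom (fun w' : UnitaryGroup.PlacesOver L v => w'.1.adicCompletion L) w))).charpoly).IsRoot x) →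
          ∑ᶠ c : ConjClasses ((UnitaryGroup.cmDatum L 3 (Matrix.of fun i j : Fin 3 => if i.val + j.val + 1 = 3 then (1 : L) else 0)).Local v), ((finExplicitCollection L (Matrix.of fun i j : Fin 3 => if i.val + j.val + 1 = 3 then (1 : L) else 0) μ (finExplicitDelta_conj_left_all L (Matrix.of fun i j : Fin 3 => if i.val + j.val + 1 = 3 then (1 : L) else 0) μ) (finExplicitDelta_conj_right_all L (Matrix.of fun i j : Fin 3 => if i.val + j.val + 1 = 3 then (1 : L) else 0) μ)) v).Δ γH (Quotient.out c) * classOrbitalIntegral mG₃ 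
            (Set.indicator {u : ((UnitaryGroup.cmDatum L 3 (Matrix.of fun i j : Fin 3 => if i.val + j.val + 1 = 3 then (1 : L) else 0)).Local v) |
            u ∈ cmLocalIntegralLevel L 3 (Matrix.of fun i j : Fin 3 => if i.val + j.val + 1 = 3 then (1 : L) else 0) v ∧
            InLevel ϖ (lb L v w) ((wMatrix L w hw u - 1) * (wMatrix L w hw u - 1))} (fun _ => (1 : ℂ))) c =
            ∑ s, coef s * stableOrbitalIntegralRel (IsLocalStablyConjH L v) mH (ψ s) γH) ∧
          -- ROW (3), Levi, transfer-shaped (law debt)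
          (∃ V ∈ 𝓝 (1 : ((UnitaryGroup.cmDatum L 2 (Matrix.of fun i j : Fin 2 => if i.val + j.val + 1 = 2 then (1 : L) else 0)).Local v × (UnitaryGroup.cmDatum L 1 (Matrix.of fun i j : Fin 1 => if i.val + j.val + 1 = 1 then (1 : L) else 0)).Local v)), ∀ γH ∈ V, IsLocalGRegular L v γH →
          (∃ (y : ((UnitaryGroup.cmDatum L 2 (Matrix.of fun i j : Fin 2 => if i.val + j.val + 1 = 2 then (1 : L) else 0)).Local v × (UnitaryGroup.cmDatum L 1 (Matrix.of fun i j : Fin 1 => if i.val + j.val + 1 = 1 then (1 : L) else 0)).Local v)) (d' : Fin 2 → (UnitaryGroup.LocalRing L v)ˣ),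
              glDiagonal 2 (UnitaryGroup.LocalRing L v) d' = ((y * γH * y⁻¹).1.val : GL (Fin 2) (UnitaryGroup.LocalRing L v))) →
          ∑ᶠ c : ConjClasses ((UnitaryGroup.cmDatum L 3 (Matrix.of fun i j : Fin 3 => if i.val + j.val + 1 = 3 then (1 : L) else 0)).Local v), ((finExplicitCollection L (Matrix.of fun i j : Fin 3 => if i.val + j.val + 1 = 3 then (1 : L) else 0) μ (finExplicitDelta_conj_left_all L (Matrix.of fun i j : Fin 3 => if i.val + j.val + 1 = 3 then (1 : L) else 0) μ) (finExplicitDelta_conj_right_all L (Matrix.of fun i j : Fin 3 => if i.val + j.val + 1 = 3 then (1 : L) else 0) μ)) v).Δ γH (Quotient.out c) * classOrbitalIntegral mG₃ 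
            (Set.indicator {u : ((UnitaryGroup.cmDatum L 3 (Matrix.of fun i j : Fin 3 => if i.val + j.val + 1 = 3 then (1 : L) else 0)).Local v) |
            u ∈ cmLocalIntegralLevel L 3 (Matrix.of fun i j : Fin 3 => if i.val + j.val + 1 = 3 then (1 : L) else 0) v ∧
            InLevel ϖ (lb L v w) ((wMatrix L w hw u - 1) * (wMatrix L w hw u - 1))} (fun _ => (1 : ℂ))) c =
            ∑ s, coef s * stableOrbitalIntegralRel (IsLocalStablyConjH L v) mH (ψ s) γH)) :
    PieceRowsWild
      (fun _ : Fin 1 => fun (L : Type) [Field L] [NumberField L] [IsCMField L] (v : HeightOneSpectrum (𝓞 ↥(maximalRealSubfield L))) (w : UnitaryGroup.PlacesOver L v)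
          (hw : IsCMField.complexConj L • w.1 = w.1) (ϖ : w.1.adicCompletion L) =>
        Set.indicator {u : ((UnitaryGroup.cmDatum L 3 (Matrix.of fun i j : Fin 3 => if i.val + j.val + 1 = 3 then (1 : L) else 0)).Local v) |
            u ∈ cmLocalIntegralLevel L 3 (Matrix.of fun i j : Fin 3 => if i.val + j.val + 1 = 3 then (1 : L) else 0) v ∧
            InLevel ϖ (lb L v w) ((wMatrix L w hw u - 1) * (wMatrix L w hw u - 1))} (fun _ => (1 : ℂ))) 0 := by
  refine pieceRowsWild_of_signedCensus shift N₀
    (fun _ : Fin 1 => fun (L : Type) [Field L] [NumberField L] [IsCMField L] (v : HeightOneSpectrum (𝓞 ↥(maximalRealSubfield L))) (w : UnitaryGroup.PlacesOver L v)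
          (hw : IsCMField.complexConj L • w.1 = w.1) (ϖ : w.1.adicCompletion L) =>
        Set.indicator {u : ((UnitaryGroup.cmDatum L 3 (Matrix.of fun i j : Fin 3 => if i.val + j.val + 1 = 3 then (1 : L) else 0)).Local v) |
            u ∈ cmLocalIntegralLevel L 3 (Matrix.of fun i j : Fin 3 => if i.val + j.val + 1 = 3 then (1 : L) else 0) v ∧
            InLevel ϖ (lb L v w) ((wMatrix L w hw u - 1) * (wMatrix L w hw u - 1))} (fun _ => (1 : ℂ)))
    0
    (fun (L : Type) [Field L] [NumberField L] [IsCMField L] (v : HeightOneSpectrum (𝓞 ↥(maximalRealSubfield L))) (w : UnitaryGroup.PlacesOver L v)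
          (hw : IsCMField.complexConj L • w.1 = w.1) (ϖ : w.1.adicCompletion L) (T : GL (Fin 3) (w.1.adicCompletion L)) =>
        {M : Submodule (Valued.integer (w.1.adicCompletion L)) (Fin 3 → w.1.adicCompletion L) |
            IsVertexLattice (galAdicCompletionMap (L := L) (IsCMField.complexConj L) hw) ϖ ((StdForm.antidiagonal 3).over (w.1.adicCompletion L)) 0 M ∧ mapGL T M = M ∧
              LatticeInLevel ϖ (lb L v w) (((T : Matrix (Fin 3) (Fin 3) (w.1.adicCompletion L)) - 1) * ((T : Matrix (Fin 3) (Fin 3) (w.1.adicCompletion L)) - 1)) M}.ncard)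
    (pieceCountDictionary_sqLevel lb) hDΔ ?_
  intro L _i1 _i2 _i3 v w hw he h2 ϖ hϖ d tE hD _iF δ hδ hδ0 μ hμu hμω _i4 _i5 _i6 _i7 _i8 _i9 _i10 _i11 νH _i12 _i13 νG₃ _i14 _i15 mH mG₃ hmH hmG
  obtain ⟨r, ψ, hψ, coef, ⟨VH, hVH, hH⟩, hrow2, hrow3⟩ := hDH L w hw he h2 ϖ hϖ d tE hD δ hδ hδ0 μ hμu hμω νH νG₃ mH mG₃ hmH hmG
  have hvσ : ∀ a, Valued.v ((galAdicCompletionMap (L := L) (IsCMField.complexConj L) hw) a) = Valued.v a := fun a => valued_galAdicCompletionMap (L := L) (IsCMField.complexConj L) hw a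
  have hϖ0 : ϖ ≠ 0 := fun h0 => by rw [h0, map_zero] at hϖ; exact WithZero.coe_ne_zero hϖ.symm
  have hϖ1 : Valued.v ϖ ≤ 1 := by rw [hϖ, ← WithZero.exp_zero]; exact WithZero.exp_le_exp.2 (by norm_num)
  -- the WINDOW `|γ₂(γ_H)_w − 1| ≤ |ϖ|^lb L v w` (★ p858805), intersected into `V`
  obtain ⟨Vz, hVz, hzw⟩ := exists_nhds_one_v_finGammaTwo_sub_one_le L w (c := ϖ ^ (lb L v w)) (pow_ne_zero _ hϖ0)
  refine ⟨r, ψ, hψ, coef, ⟨VH ∩ Vz, Filter.inter_mem hVH hVz, ?_⟩, hrow2, hrow3⟩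
  intro γH hγ hreg f hf a b z ha hb hz hzγ hra hrb ha1 hb1 n₁ n₂ n₃ hE k hk Γ hΓ tb htb i B hB hNP hrel
  rw [hH γH hγ.1 hreg f hf a b z ha hb hz hzγ hra hrb ha1 hb1 n₁ n₂ n₃ hE k hk Γ hΓ tb htb i B hB hNP hrel]
  have hz1 : Valued.v z = 1 := UnitaryThreeFourFrame.v_eq_one_of_mul_map_eq_one hvσ hz
  have hzm : Valued.v (z - 1) ≤ Valued.v ϖ ^ (lb L v w) := by rw [hzγ, ← map_pow]; exact hzw γH hγ.2
  congr 1
  refine Finset.sum_congr rfl fun b' _ => ?_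
  rw [ncard_sqLevel_eq_of_coe_eq_smul (galAdicCompletionMap (L := L) (IsCMField.complexConj L) hw) hϖ0 hϖ1 hz1 hzm (htb b')]

end Summit.HodgeConjecture.HodgeConjecture.Cruxes.H413.F0P3cDyRamPieceRowsLevelsOfFrameSignedCensus

end
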